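import Summits.QuantumAdvantage.QuantumAdvantage.Theorems.EchoDialB

/-! # EchoDialC — part 3/5 of the landing twins of NODE «EchoDial» (decomp-qadv lens-2; node file
`g22/EchoDial.lean`, sha256 2019ca7807e3a40c…; generator `g23/tree/gen_twins.py`: namespace
`Theses.EchoDial` → `Theorems.EchoDial`, cut at declaration boundaries, docstrings added where missing, nothing else).
Content: §4 THE DIAL — `StabEcho`, the special piece `EchoLoss3` PROVED (`echoLoss3`), the residual `HighEchoNonCounterLoss3`,
`closes` BY NAME onto `Theses.SparsityDial.NonCounterGenericLoss3` (stmt-QuantumAdvantage-27009) through the tree junction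
`Theorems.SparsityDial.nonCounterGenericLoss3_iff_node`, the D-level readings and the iffs.  The node's full docstring follows. -/

/-!
# NODE «EchoDial» (decomp-qadv lens-2 «structural dichotomy: special vs generic», generation 22; RESIDUAL MODE on
route-QuantumAdvantage-SparsityDial (DRAFT) rev 2: the residual OF RECORD is B = `Theses.SparsityDial.NonCounterGenericLoss3`
(stmt-QuantumAdvantage-27009, gen 1, leaf IDEA-NEEDED «AND-bottom loss law»), the generic child of the split
D = `Theses.SparsityDial.DenseGenericLoss3` (27656) `= CounterLoss3 (27008) ∧ B` landed from lens-2 g21 «CounterDial»)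

**Target (verbatim, BY NAME):** `Summit.QuantumAdvantage.QuantumAdvantage.Theses.SparsityDial.NonCounterGenericLoss3` (B;
`Iff.rfl`-junction with the tree piece `Theorems.CounterDial.NonCounterGenericLoss3`, which this file `open`s as
`NonCounterGenericLoss3`); D-level reading onto `Theses.SparsityDial.DenseGenericLoss3` through the route's glue item.
**Node:** `B ⟸ EchoLoss3 ∧ HighEchoNonCounterLoss3`, `closes : EchoLoss3 → HighEchoNonCounterLoss3 → B` (§4), with the
special half `EchoLoss3` **PROVED** (`echoLoss3`; so `closes' : HighEchoNonCounterLoss3 → B`, and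
`closesD_items : HighEchoNonCounterLoss3 → Theses.SparsityDial.CounterLoss3 → D` by the landed `counterSplitGlue3`).
A **LAW node** (like g19 «ResponseDial», g20 «BlindDial»; unlike g21's genuine split): the decided half is a theorem, so
the re-typed residual is equivalent to its parent OUTRIGHT (`highEchoNC_iff_item : R_B ↔ B`; on D, `highEcho_iff_dense :
R_D ↔ D`) — tagged COSTUME-by-own-theorem below, not sold as a difficulty split (critic C2).  What the node adds is the
LAW (a new decided class, for every degree at once) and the sharper typing + a certified inhabitant of what is left.

## Pieces and tags
* `EchoLoss3` (E) — **WEAKER, PROVED** (`echoLoss3`, `C = 4`, `n₀ = 16`): every strategy of degree `≤ (log₂ n)^c` that is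
  CHEAPLY ECHO-STRUCTURED (`StabEcho (c+1) P`, below) loses `≥ n^{-4}` of the odd class.  No density hypothesis.
* `HighEchoNonCounterLoss3` (R_B) — **COSTUME-by-own-theorem** (`R_B ↔ B` via E): B restricted to fields that are NOT
  cheaply echo-structured.  **UNDECIDED(test: `HxLoss3`)** — inhabited by the certified family `hxStrat` of §5.
* `HighEchoGenericLoss3` (R_D) — the same cut on D (`R_D ↔ D`, `R_D → R_B`); recorded for the D-level reading only.
* `Theses.SparsityDial.CounterLoss3` (A, item 27008, g21) — ATTACKABLE per the route, untouched here; enters only the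
  D-level reading `closesD_items`.

## The dial (new in the lineage V1–V22 and on the bus): the ECHO DEGREE of the deviation field
Fix an odd input `x`, `F` separated pair-flip sites `b` (`SitesF`: `b_i + 2 ≤ b_j`, the lineage's `orbF` orbit of `2^F`
odd inputs `x^ε`) and a position `k`.  The **echo** of `k` is the Boolean function `ε ↦ [k ∈ dev P (x^ε)]` on `𝔽₂^F`;
`EchoDeg d b P x` says every position's echo has `𝔽₂`-DEGREE `≤ d` (an explicit family `M` of monomials of size `≤ d`).
Rung 0 of the lineage (g14 dark / frozen windows) is `d = 0` (`echoDeg_zero_of_frozen`); rung 1 (g19 ADDITIVE response,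
`AddResp`) is `d = 1` (`echoDeg_one_of_addResp`); readers that are ANDs / XORs-of-ANDs of `≤ d` flipped literals have echo
degree `≤ d`.  The axis is the `𝔽₂`-degree IN THE FLIP VARIABLES — skew by construction to the `𝔽₃`-degree of the
strategy (lens-3), to light cones / juntas (lens-1), to holonomy and stabilizer sparsity (g≤18), to blindness (g20) and to
g21's COUNTER FORM: `apStrat` is counter-form AND echo-structured (rung 1), the pure `MOD₃` counter `hcStrat` (g19) is
counter-form with echo degree `> d` at EVERY input and placement (`hc_not_echoDeg`, the slice argument of §5(c)),
`AND`-readers of `≥ 2` flipped literals are echo-structured and not counter-form, and `hxStrat` (§5) is neither.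

## ★ Engine: the ECHO LAW for EVERY degree (§1–§2) — certificates that TENSOR
Along the orbit the kernel count of position `k` moves `Z₃`-affinely, `c_k(x^ε) = c_k(x) + phase z ε g` with
`g = #{sites left of k}` (tree `cN_orbF_cast`), and `x^ε` wins iff `#{k ∈ dev : c_k ≢ 2}` is odd (tree `win_iff`).  A
**certificate** for `(d, F)` at site signs `z` is an ODD-size list `Λ ⊆ 𝔽₂^F` on which every test
`mono_S(ε) · [c + phase z ε g ≢ 2]` (`|S| ≤ d`, all `g, c`) has EVEN weight (`IsCert d z Λ`; `CertFamily d F := ∀ z, ∃ Λ`).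
If every echo has degree `≤ d`, the win indicator restricted to `Λ` is a sum of such tests, so `Σ_Λ win ≡ 0 (2)` while
all-win would give `|Λ| ≡ 1`: **some orbit point loses** (`echo_orbit_loses`), and counting orbits (tree `card_filter_orbF`)
`#{odd ∧ EchoDeg d b P ·} ≤ 2^F · #{odd losers}` (`echo_loss_count`).  ★ `isCert_tensor`: certificates MULTIPLY —
`IsCert d₁ z₁ Λ₁ → IsCert d₂ z₂ Λ₂ → IsCert (d₁+d₂+1) (z₁ ++ z₂) (Λ₁ × Λ₂)` (a monomial of size `≤ d₁+d₂+1` is small on one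
factor; the phase is additive across the cut, `phase_append`; parities factor, `countP_prodList`).  Seeds: `(0,3)` by
`decide` on 8 sign patterns × 5-point lists (`base3_core`), `(1,5)` = the tree's 32 certificates `ResponseDial.certOK_lam`
re-read (`certFamily_one_five`); hence `certFamily_all d : CertFamily d (3(d+1))` for EVERY `d`, and the law
`echo_loss_count_all` with factor `2^{3(d+1)}`.  Numerics (`num/echo_cert.py`, exhaustive linear algebra over `𝔽₂`,
seconds; `num/TABLE.md`): the least `F` with a certificate for every `z` is `F = 3, 5, 7` for `d = 0, 1, 2` (below it the
all-ones vector is in the test span for EVERY `z`), certificate sizes found `5, 21, 85 = (4^{d+2}−1)/3`; conjecture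
`F(d) = 2d+3` (the node uses the proved `3(d+1)`); product certificates re-checked (`(0,3)⊗(0,3)`: 64/64, `(0,3)⊗(1,5)`:
256/256); `z`-INDEPENDENT certificates do not exist (`num/echo_univ.py`: the test span over all sign patterns is full for
`(0,≤5), (1,≤7), (2,≤8)`), so the sign-dependence inherited from g19 is essential.

## The special class and the theorem (§4)
`StabEcho e P`: some gauge `s` of degree `≤ (log₂N)^e` (the `StabFew`/`StabAdd`/`StabCounter` format), some `d ≤ log₂ N`
and some admissible placement of `3(d+1)` sites make `pad P s` echo with degree `≤ d` at all but `≤ 2^{N-1}/log₂N` odd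
inputs.  `echoLoss3`: gauge invariance of outcomes (`rel_pad_iff`), the law with `2^{3(d+1)} ≤ 8n³`, the a.e. clause, and
`real_loss_of_frac_pow` (`#odd ≤ M·#losers`, `M ≤ n^C` ⟹ the real loss shape; the tree's `real_loss_of_frac` is `C = 1`).

## The residual is inhabited and certified (§5): the HALF-COUNTER × LITERAL-PAIR family `hxStrat`
Antipodal pointers on `[1, N/2)`; elsewhere the canonical guess toggled by `[Σ_{odd i} x_i ≡ 0 (3)] ⊕ (x₀ ∧ x₂)` (degree 6).
(a) dense: `hx_in_dense_class` (tree `not_polylogSparse_of_agree`); (b) NOT counter-form at the zero gauge: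
`hx_not_counterForm_zero` (finite core `hx_core`, `3⁷·2³` cases by `decide`; with 5 local cells the literal `x₀` alone
would FAIL — on odd inputs a single literal is an affine function of the other cells — whence the pair); (c) ★ NOT
echo-structured at the zero gauge: `hx_not_echoDeg` — for EVERY `d`, EVERY admissible placement of `≥ d+3` sites and
EVERY input the echo at position `0` has degree `> d` — `slice_not_lowDeg` via `echoDeg_castLE` (degree only drops on sub-orbits),
`lodd_orbF_gen` (the counter moves by `Σ ±ε_i`), SUBCUBE PARITY (`even_mono_count`: a degree-`≤ d` function has even
weight on the `(d+1)`-cube behind the first two sites, on which the literal pair is constant, `orbF_app_low`) against the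
**period-3 parity lemma** `cnt3_parity` (for non-zero weights the parity of `#{τ ∈ 𝔽₂^m : a + Σ s_t τ_t ≡ 0}` is never
constant in `a ∈ Z₃`; induction `N_{m+1}(a) = N_m(a) + N_m(a+s)`), every residue being reached by the first two sites
(`reach3`); so `hx_not_stabEcho_zero`.  Its loss `HxLoss3` is the UNDECIDED(test) rung (`hxLoss3_of_dense : D → HxLoss3`).
Honest scope: like every exemplar of the lineage, (b) and (c) are certified at the ZERO gauge only.

## Leaves under R_B
* ATTACKABLE — `hxStrat`-type readers (one `MOD₃` counter ⊕ a few literals): not `BlindDial.Blind` only because the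
  literals sit on moved cells `0, 2`; a blind law with SHIFTED move cells (the g20 proof translated) should decide them.
* IDEA-NEEDED — parity-MIXED counters (e.g. `[Σ_even ≡ 0] ⊕ [Σ_odd ≡ 0]`): high echo only IN MEASURE (the two slice
  parities can align on a `(d+1)`-cube when the even/odd offsets match: an averaged subcube-parity law is the missing tool).
* BARRIER-adjacent — generic high-echo non-counter fields: along an orbit the win bit is `MOD₂ ∘ (AND_{≤d} · MOD₃^{prefix})`;
  the echo law is an exact DUAL CERTIFICATE that `1` is not in the `𝔽₂`-span of these tests for `F ≥ 3(d+1)` flip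
  variables — the structured (prefix-linear `MOD₃`, few variables) corner of the Constant-Degree landscape recorded in
  `Literature.Barriers.QuantumAdvantage.TwoModuliDepthTwo` ([BarringtonStraubingTherien1990] Thm 7 = bottom fan-in 1;
  general `AND_d` bottom «wide open» [KawalekWeiss2023]).  The node does not touch that barrier: R_B is exactly the fields
  whose bottom layer is structured by NEITHER modulus (not `Z₃`-linear: ¬counter; not low `𝔽₂`-degree in flips: ¬echo).

## Why novel / why each piece is strictly weaker
Novel: the first law of the lineage parametrised by an UNBOUNDED structural degree, obtained from two finite seeds by a
tensor identity on certificates (V1–V21 laws are single finite certificates: g14 frozen, g19 additive = the `d = 0, 1`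
rungs here, g20 blind, g21 dark window); the dial «`𝔽₂`-degree of the deviation echo along pair-flip orbits» is absent
from V1–V22 and from the bus.  Weaker: E is D restricted to a class containing fields outside every earlier decided class
(ANDs of `2 ≤ d ≤ log₂N` flipped literals are neither dark, additive, blind-by-placement nor counter-form) and is PROVED;
R_B/R_D are restrictions of B/D (costume only through E); A is g21's.  Nothing here proves QuantumAdvantage's summit or D;
rung currency: one new decided class (all echo degrees `≤ log₂ N`), one certified residual inhabitant, zero sorries.
-/


set_option linter.dupNamespace false
noncomputable section
open scoped Classical

namespace Summit.QuantumAdvantage.QuantumAdvantage.Theorems.EchoDial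
open Finset
open Literature.Computability.QuantumComplexity Literature.Computability.QuantumComplexity.RingHLF
open Literature.Computability.MetaComplexity Literature.Computability.MetaComplexity.Smolensky
open Summit.QuantumAdvantage.AdviceFreeQNC0 hiding sgn3
open Summit.QuantumAdvantage.QuantumAdvantage.Theorems.AnchorDial (outB dev cN orbF cN_orbF_cast oddZeros_orbF
  orbF_apply_of_far card_filter_orbF orbF_false win_iff gCond_iff_cN three_counts card_odd_ge loss_shape_mono)
open Summit.QuantumAdvantage.QuantumAdvantage.Theorems.AnchorDial.Core (ct sg)
open Summit.QuantumAdvantage.QuantumAdvantage.Theorems.HolonomyDial (gCond card_odd_le)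
open Summit.QuantumAdvantage.QuantumAdvantage.Theorems.StabilizerDial (pad pad_mem rel_pad_iff StabFew apStrat apStrat_mem)
open Summit.QuantumAdvantage.QuantumAdvantage.Theorems.SparsityDial (stabFew_mono_mr one_le_logpow)
open Summit.QuantumAdvantage.QuantumAdvantage.Theorems.ResponseDial (lodd lodd_mem lodd_eq_sum qpoly qpoly_mem qbit qpoly_apply
  hcStrat mem_dev_hcStrat_iff
  sgn3 sgn3_ne dev_pad_zero not_polylogSparse_of_agree orbF_apply mod3_ne_two castZ2_of_mod_eq_zero
  castZ2_of_mod_eq_one εOf sF lam CertOK certOK_lam AddResp)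
open Summit.QuantumAdvantage.QuantumAdvantage.Theses.SparsityDial (DenseGenericLoss3)
open Summit.QuantumAdvantage.QuantumAdvantage.Theorems.CounterDial (StabCounter CounterLoss3 NonCounterGenericLoss3 lin CounterForm
  xloc xloc_castLE oddZeros_xloc lin_xloc bsel mem_iff_bsel card_false_five)
open Summit.QuantumAdvantage.QuantumAdvantage.Theorems.HolonomyDial (tPoly tPoly_mem tPoly_apply xorP xorP_mem
  xorP_apply_bool mono_singleton_apply)

/-! ## §4  THE DIAL: cheaply ECHO-STRUCTURED (special, DECIDED) versus HIGH-ECHO (generic, residual) -/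

section Dial
variable {N : ℕ}

/-- from `#odd ≤ M · #odd-losers` with `M ≤ n^C` to the real loss form (generic exponent; cf. the tree's
`SparsityDial.real_loss_of_frac`, which is the case `C = 1`). -/
theorem real_loss_of_frac_pow {n M C : ℕ} (hM : 1 ≤ M) (hMn : M ≤ n ^ C) (h3 : 3 ≤ n)
    (P : Fin n → CubeFn (ZMod 3) n)
    (hq : (univ.filter fun x : Fin n → Bool => OddZeros x).card ≤
      M * (univ.filter fun x : Fin n → Bool => OddZeros x ∧ ¬ Rel x (outB P x)).card) :
    ((univ.filter fun x : Fin n → Bool => OddZeros x ∧ Rel x (fun i => decide (P i x = 1))).card : ℝ) ≤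
      (1 - 1 / (n : ℝ) ^ C) * (2 : ℝ) ^ (n - 1) := by
  set W := (univ.filter fun x : Fin n → Bool =>
    OddZeros x ∧ Rel x (fun i => decide (P i x = 1))).card with hW
  set Lo := (univ.filter fun x : Fin n → Bool =>
    OddZeros x ∧ ¬ Rel x (fun i => decide (P i x = 1))).card with hLo
  set O := (univ.filter fun x : Fin n → Bool => OddZeros x).card with hO
  have hq' : O ≤ M * Lo := hq
  have hsplit : W + Lo = O := by
    have hs := Finset.card_filter_add_card_filter_not
      (s := univ.filter fun x : Fin n → Bool => OddZeros x)
      (fun x : Fin n → Bool => Rel x (fun i => decide (P i x = 1)))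
    rw [filter_filter, filter_filter] at hs
    exact hs
  have hOle : O ≤ 2 ^ (n - 1) := card_odd_le (n := n) (by omega)
  have hkey : M * W + O ≤ M * O := by
    have : M * O = M * W + M * Lo := by rw [← hsplit, mul_add]
    omega
  have hM' : (1 : ℝ) ≤ M := by exact_mod_cast hM
  have hMn' : (M : ℝ) ≤ (n : ℝ) ^ C := by exact_mod_cast hMn
  have hkey' : (M : ℝ) * W + O ≤ M * O := by exact_mod_cast hkey
  have hOle' : (O : ℝ) ≤ (2 : ℝ) ^ (n - 1) := by exact_mod_cast hOle
  have hMpos : (0 : ℝ) < M := by linarith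
  have hW1 : (W : ℝ) ≤ O - O / M := by
    have h : (O : ℝ) / M * M = O := div_mul_cancel₀ _ (ne_of_gt hMpos)
    nlinarith [hkey', h, hMpos]
  have hfac1 : (0 : ℝ) ≤ 1 - 1 / M := by
    rw [sub_nonneg, div_le_one hMpos]
    exact hM'
  have hfac2 : 1 - 1 / (M : ℝ) ≤ 1 - 1 / (n : ℝ) ^ C := by
    have := one_div_le_one_div_of_le hMpos hMn'
    linarith
  calc (W : ℝ) ≤ O - O / M := hW1
    _ = (1 - 1 / M) * O := by ring
    _ ≤ (1 - 1 / M) * (2 : ℝ) ^ (n - 1) := mul_le_mul_of_nonneg_left hOle' hfac1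
    _ ≤ (1 - 1 / (n : ℝ) ^ C) * (2 : ℝ) ^ (n - 1) := mul_le_mul_of_nonneg_right hfac2 (by positivity)

/-- **CHEAPLY ECHO-STRUCTURED at level `e`** (the SPECIAL class; gauge format of `StabFew` / `StabAdd` / `StabCounter`):
some stabilizer gauge `s` of degree `≤ (log₂ N)^e`, some echo degree `d ≤ log₂ N` and some admissible placement of
`3(d+1)` separated pair-flip sites make the padded field echo with `𝔽₂`-degree `≤ d` at almost every odd input
(a.e. = the lineage's `log₂ N · #bad ≤ 2^(N-1)`).  Contains (up to re-placement) the dark-by-design and the cheaply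
additivizable classes (rungs 0, 1) and every field whose readers are `𝔽₂`-polynomials of degree `≤ log₂ N` in the
flipped cells (ANDs of `≤ log₂ N` flipped literals, XORs of such). -/
def StabEcho (e : ℕ) (P : Fin N → CubeFn (ZMod 3) N) : Prop :=
  ∃ s : Fin N → CubeFn (ZMod 3) N, (∀ i, s i ∈ lowDeg (ZMod 3) N ((Nat.log 2 N) ^ e)) ∧
    ∃ d : ℕ, d ≤ Nat.log 2 N ∧ ∃ b : Fin (3 * (d + 1)) → ℕ, SitesF N (3 * (d + 1)) b ∧
      Nat.log 2 N * (univ.filter fun x : Fin N → Bool =>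
        OddZeros x ∧ ¬ EchoDeg d b (pad P s) x).card ≤ 2 ^ (N - 1)

/-- **piece E — the SPECIAL half `EchoLoss3`** (a THEOREM, `echoLoss3`): every low-degree strategy that is cheaply
echo-structured loses at least the fraction `n^{-4}` of the odd class (no density hypothesis needed). -/
def EchoLoss3 : Prop :=
  ∃ C : ℕ, ∀ c : ℕ, ∃ n₀ : ℕ, ∀ n ≥ n₀, ∀ P : Fin n → CubeFn (ZMod 3) n,
    (∀ i, P i ∈ lowDeg (ZMod 3) n ((Nat.log 2 n) ^ c)) → StabEcho (c + 1) P →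
      ((univ.filter fun x : Fin n → Bool => OddZeros x ∧ Rel x (fun i => decide (P i x = 1))).card : ℝ)
        ≤ (1 - 1 / (n : ℝ) ^ C) * (2 : ℝ) ^ (n - 1)

/-- **THE SPECIAL HALF IS A THEOREM** (`C = 4`, `n₀ = 16`): the gauge changes no outcome (`rel_pad_iff`); by the ECHO
LAW the echo-structured odd inputs number at most `8^(d+1) ≤ 8n³ ×` the odd losers; the others are at most `#odd / 2`. -/
theorem echoLoss3 : EchoLoss3 := by
  refine ⟨4, fun c => ⟨16, fun n hn P hP hecho => ?_⟩⟩
  obtain ⟨s, hs, d, hd, b, hb, hae⟩ := hecho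
  have hL : 2 ≤ Nat.log 2 n := Nat.le_log_of_pow_le (by norm_num) (by norm_num; omega)
  have hlaw := echo_loss_count_all (N := n) (by omega) d hb (pad P s)
  have hlos : (univ.filter fun x : Fin n → Bool => OddZeros x ∧ ¬ Rel x (outB (pad P s) x)) =
      univ.filter fun x : Fin n → Bool => OddZeros x ∧ ¬ Rel x (outB P x) :=
    filter_congr fun x _ => by rw [rel_pad_iff]
  rw [hlos] at hlaw
  have hsplit := Finset.card_filter_add_card_filter_not
    (s := univ.filter fun x : Fin n → Bool => OddZeros x) (fun x : Fin n → Bool => EchoDeg d b (pad P s) x)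
  rw [filter_filter, filter_filter] at hsplit
  have hge : 2 ^ (n - 1) ≤ (univ.filter fun x : Fin n → Bool => OddZeros x).card := card_odd_ge (by omega)
  set O := (univ.filter fun x : Fin n → Bool => OddZeros x).card
  set G := (univ.filter fun x : Fin n → Bool => OddZeros x ∧ EchoDeg d b (pad P s) x).card
  set Bd := (univ.filter fun x : Fin n → Bool => OddZeros x ∧ ¬ EchoDeg d b (pad P s) x).card
  set L := (univ.filter fun x : Fin n → Bool => OddZeros x ∧ ¬ Rel x (outB P x)).card
  set K := 2 ^ (3 * (d + 1)) with hKdef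
  clear_value K
  have h2 : 2 * Bd ≤ O := le_trans (Nat.mul_le_mul_right Bd hL) (le_trans hae hge)
  have h3 : O ≤ K * L + Bd := by rw [← hsplit]; exact Nat.add_le_add_right hlaw _
  have h4 : O ≤ (2 * K) * L := by rw [mul_assoc]; omega
  have hd2 : 2 ^ d ≤ n := le_trans (Nat.pow_le_pow_right (by norm_num) hd) (Nat.pow_log_le_self 2 (by omega))
  have hK : K ≤ 8 * n ^ 3 := by
    have e : K = 8 * (2 ^ d) ^ 3 := by rw [hKdef]; ring
    rw [e]; exact Nat.mul_le_mul_left 8 (Nat.pow_le_pow_left hd2 3)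
  have hK1 : 1 ≤ K := by rw [hKdef]; exact Nat.one_le_two_pow
  have h16 : 16 * n ^ 3 ≤ n ^ 4 := by
    calc 16 * n ^ 3 ≤ n * n ^ 3 := Nat.mul_le_mul_right _ hn
      _ = n ^ 4 := by ring
  have hM1 : 1 ≤ 2 * K := by omega
  have hM2 : 2 * K ≤ n ^ 4 := by omega
  exact real_loss_of_frac_pow (M := 2 * K) (C := 4) hM1 hM2 (by omega) P h4

/-- **piece R_D — the RESIDUAL of D**: `DenseGenericLoss3` restricted to strategies that are NOT cheaply
echo-structured (every cheap gauge, every echo degree `d ≤ log₂ n`, every placement of `3(d+1)` sites leaves more than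
`2^(n-1)/log₂ n` odd inputs echoing with `𝔽₂`-degree `> d`: the HIGH-ECHO fields). -/
def HighEchoGenericLoss3 : Prop :=
  ∃ a : ℕ, ∃ C : ℕ, ∀ c : ℕ, ∃ n₀ : ℕ, ∀ n ≥ n₀, ∀ P : Fin n → CubeFn (ZMod 3) n,
    (∀ i, P i ∈ lowDeg (ZMod 3) n ((Nat.log 2 n) ^ c)) →
      ¬ StabFew ((Nat.log 2 n) ^ a) 0 (c + 1) P → ¬ StabEcho (c + 1) P →
        ((univ.filter fun x : Fin n → Bool => OddZeros x ∧ Rel x (fun i => decide (P i x = 1))).card : ℝ)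
          ≤ (1 - 1 / (n : ℝ) ^ C) * (2 : ℝ) ^ (n - 1)

/-- **piece R_B — the RESIDUAL of the tree's `CounterDial.NonCounterGenericLoss3`** (B of generation 21): dense, NOT
cheaply counter-form AND NOT cheaply echo-structured ⟹ polynomial loss. -/
def HighEchoNonCounterLoss3 : Prop :=
  ∃ a : ℕ, ∃ C : ℕ, ∀ c : ℕ, ∃ n₀ : ℕ, ∀ n ≥ n₀, ∀ P : Fin n → CubeFn (ZMod 3) n,
    (∀ i, P i ∈ lowDeg (ZMod 3) n ((Nat.log 2 n) ^ c)) →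
      ¬ StabFew ((Nat.log 2 n) ^ a) 0 (c + 1) P → ¬ StabCounter (c + 1) P → ¬ StabEcho (c + 1) P →
        ((univ.filter fun x : Fin n → Bool => OddZeros x ∧ Rel x (fun i => decide (P i x = 1))).card : ℝ)
          ≤ (1 - 1 / (n : ℝ) ^ C) * (2 : ℝ) ^ (n - 1)

/-- `E → R_D → D` BY NAME (case split on `StabEcho (c+1) P`; constants merged by `max`). -/
theorem closesD (hE : EchoLoss3) (hR : HighEchoGenericLoss3) : DenseGenericLoss3 := by
  obtain ⟨C₁, h₁⟩ := hE
  obtain ⟨a, C₂, h₂⟩ := hR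
  refine ⟨a, max C₁ C₂, fun c => ?_⟩
  obtain ⟨n₁, hn₁⟩ := h₁ c
  obtain ⟨n₂, hn₂⟩ := h₂ c
  refine ⟨max (max n₁ n₂) 1, fun n hn P hP hgen => ?_⟩
  have hn1 : 1 ≤ n := le_trans (le_max_right _ _) hn
  by_cases hecho : StabEcho (c + 1) P
  · exact loss_shape_mono hn1 (le_max_left _ _) _ _ (by positivity)
      (hn₁ n (le_trans (le_trans (le_max_left _ _) (le_max_left _ _)) hn) P hP hecho)
  · exact loss_shape_mono hn1 (le_max_right _ _) _ _ (by positivity)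
      (hn₂ n (le_trans (le_trans (le_max_right _ _) (le_max_left _ _)) hn) P hP hgen hecho)

/-- `E → R_B → B` BY NAME onto the tree's `Theorems.CounterDial.NonCounterGenericLoss3`. -/
theorem closesB (hE : EchoLoss3) (hR : HighEchoNonCounterLoss3) : NonCounterGenericLoss3 := by
  obtain ⟨C₁, h₁⟩ := hE
  obtain ⟨a, C₂, h₂⟩ := hR
  refine ⟨a, max C₁ C₂, fun c => ?_⟩
  obtain ⟨n₁, hn₁⟩ := h₁ c
  obtain ⟨n₂, hn₂⟩ := h₂ c
  refine ⟨max (max n₁ n₂) 1, fun n hn P hP hgen hnc => ?_⟩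
  have hn1 : 1 ≤ n := le_trans (le_max_right _ _) hn
  by_cases hecho : StabEcho (c + 1) P
  · exact loss_shape_mono hn1 (le_max_left _ _) _ _ (by positivity)
      (hn₁ n (le_trans (le_trans (le_max_left _ _) (le_max_left _ _)) hn) P hP hecho)
  · exact loss_shape_mono hn1 (le_max_right _ _) _ _ (by positivity)
      (hn₂ n (le_trans (le_trans (le_max_right _ _) (le_max_left _ _)) hn) P hP hgen hnc hecho)

/-- **`closes` — the node's deciding theorem onto the LEDGER RESIDUAL OF RECORD** `Theses.SparsityDial.NonCounterGenericLoss3`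
(B, stmt-QuantumAdvantage-27009, route-QuantumAdvantage-SparsityDial rev 2), BY NAME, from the two pieces `E` (special,
PROVED below: `echoLoss3`) and `R_B` (residual); the item is the tree piece `CounterDial.NonCounterGenericLoss3` with
`StabCounter` unfolded (junction `Theorems.SparsityDial.nonCounterGenericLoss3_iff_node`, `Iff.rfl`). -/
theorem closes (hE : EchoLoss3) (hR : HighEchoNonCounterLoss3) :
    Summit.QuantumAdvantage.QuantumAdvantage.Theses.SparsityDial.NonCounterGenericLoss3 :=
  Summit.QuantumAdvantage.QuantumAdvantage.Theorems.SparsityDial.nonCounterGenericLoss3_iff_node.2 (closesB hE hR)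

/-- … with the proved half discharged: `R_B` ALONE gives the item B. -/
theorem closes' (hR : HighEchoNonCounterLoss3) : Summit.QuantumAdvantage.QuantumAdvantage.Theses.SparsityDial.NonCounterGenericLoss3 :=
  closes echoLoss3 hR

/-- the D-level reading through the route's OWN split (rev 2): `R_B →` item A (`Theses.SparsityDial.CounterLoss3`,
stmt-QuantumAdvantage-27008) `→` D (`Theses.SparsityDial.DenseGenericLoss3`, stmt-QuantumAdvantage-27656), by the landed
glue `Theorems.SparsityDial.counterSplitGlue3`. -/
theorem closesD_items (hR : HighEchoNonCounterLoss3) (hA : Summit.QuantumAdvantage.QuantumAdvantage.Theses.SparsityDial.CounterLoss3) :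
    DenseGenericLoss3 :=
  Summit.QuantumAdvantage.QuantumAdvantage.Theorems.SparsityDial.counterSplitGlue3 hA (closes' hR)

/-- the same through the generation-21 node pieces (`Theorems.CounterDial.closes`). -/
theorem closesD_nodes (hR : HighEchoNonCounterLoss3) (hA : CounterLoss3) : DenseGenericLoss3 :=
  Summit.QuantumAdvantage.QuantumAdvantage.Theorems.CounterDial.closes hA (closesB echoLoss3 hR)

/-- since `E` is a theorem, `R_D` alone gives D … -/
theorem dense_of_highEcho (hR : HighEchoGenericLoss3) : DenseGenericLoss3 := closesD echoLoss3 hR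

/-- … and conversely (N-test, restriction): `D → R_D`, -/
theorem highEcho_of_dense (hD : DenseGenericLoss3) : HighEchoGenericLoss3 := by
  obtain ⟨a, C, h⟩ := hD
  exact ⟨a, C, fun c => by
    obtain ⟨n₀, hn₀⟩ := h c
    exact ⟨n₀, fun n hn P hP hgen _ => hn₀ n hn P hP hgen⟩⟩

/-- so `R_D ⟺ D` OUTRIGHT: an honest LAW node on D (the special half decided, the residual re-typed). -/
theorem highEcho_iff_dense : HighEchoGenericLoss3 ↔ DenseGenericLoss3 := ⟨dense_of_highEcho, highEcho_of_dense⟩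

/-- likewise on B: `R_B → B`, -/
theorem nonCounter_of_highEchoNC (hR : HighEchoNonCounterLoss3) : NonCounterGenericLoss3 := closesB echoLoss3 hR

/-- `B → R_B` (N-test, restriction), -/
theorem highEchoNC_of_nonCounter (hB : NonCounterGenericLoss3) : HighEchoNonCounterLoss3 := by
  obtain ⟨a, C, h⟩ := hB
  exact ⟨a, C, fun c => by
    obtain ⟨n₀, hn₀⟩ := h c
    exact ⟨n₀, fun n hn P hP hgen hnc _ => hn₀ n hn P hP hgen hnc⟩⟩

/-- `R_B ⟺ B`. -/
theorem highEchoNC_iff_nonCounter : HighEchoNonCounterLoss3 ↔ NonCounterGenericLoss3 :=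
  ⟨nonCounter_of_highEchoNC, highEchoNC_of_nonCounter⟩

/-- `R_B ⟺` the ledger item B (stmt-QuantumAdvantage-27009): COSTUME-by-own-theorem, stated by name. -/
theorem highEchoNC_iff_item : HighEchoNonCounterLoss3 ↔ Summit.QuantumAdvantage.QuantumAdvantage.Theses.SparsityDial.NonCounterGenericLoss3 :=
  highEchoNC_iff_nonCounter.trans Summit.QuantumAdvantage.QuantumAdvantage.Theorems.SparsityDial.nonCounterGenericLoss3_iff_node.symm

/-- and `R_D → R_B` (the B-cut residual is the smaller one; the node's live residual is `R_B`). -/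
theorem highEchoNC_of_highEcho (hR : HighEchoGenericLoss3) : HighEchoNonCounterLoss3 :=
  highEchoNC_of_nonCounter (Summit.QuantumAdvantage.QuantumAdvantage.Theorems.CounterDial.nonCounter_of_dense
    (dense_of_highEcho hR))

end Dial

end Summit.QuantumAdvantage.QuantumAdvantage.Theorems.EchoDial
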